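import Literature.AnabelianGeometry.EtaleTheta.Discharge.Sec5Prop55SgpCupConjOfBiKummerData
import Literature.AnabelianGeometry.EtaleTheta.Discharge.Sec5EnvelopeTopology
import Literature.AnabelianGeometry.EtaleTheta.ThetaRigidity

/-!
# [EtTh] Prop. 5.5 leaf P55-L06c (`hcup` / `hKR`): the Galois-equivariance of the bi-Kummer cocycle over `l·Δ_Θ` FROM the §5↔§2 dictionary and `Δ_Θ ≅ Ẑ(1)` (pp. 272, 324, 327–328, 331 / PDF pp. 46, 98, 101–102, 105)

Mochizuki, *The étale theta function …*, Publ. RIMS **45** (2009)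
[cite: MochizukiEtTh2009, Prop 5.5 proof p.327–328 (PDF pp.101–102); Prop 5.2 (iii) p.324 (PDF p.98); §2 p.272 (PDF p.46)].
Layer L2 of the abc-iut cell, seat abc-iut-L2-t11 (gen 3); GAP-LEDGER row **G-L6t23-3** (`hKR`), L2-lead ROW #13-addendum
(R136).  PROOF-ONLY (no definition, no named fact; nothing landed is edited).

The structural binder `hcup` of abc-iut-w4-d008's `Thm56Sub.cyclotomicRigidity_of_laws` / abc-iut-w5-d020's
`cyclotomicRigidity_ofBiKummerData_of_laws` — for `g ∈ Aut_D(B_N^bs)` and `k ∈ H_{B_N}` over `(l·Δ_Θ)_{B_N}`,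
`s^⊔-gp_N(g k g⁻¹) = s^⊓-gp_N(g) · s^⊔-gp_N(k) · s^⊓-gp_N(g)⁻¹` — equivalently (abc-iut-L6-t23, `hcup_iff_pull_root_mul`,
`Sec5Prop55SgpCupConjOfBiKummerData.lean`) the Kummer-cocycle law `hKR` of the `N`-th root at abc-iut-L2-t4's assembled data, is
NOT a new origin clause: it is the §5 shadow of two dictionary facts and one interface field, and is derived here GENERICALLY
(any `𝔉 : ThetaFrobenioid`, any §2 `RD : RigidData`):
* Prop. 5.2 (iii)'s VALUE identification `ThetaSectionCompat` (this seat, gen 0, `Sec5EnvelopeTopology.lean`; F-0521-class binder):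
  the bi-Kummer difference `s^⊔-gp_N(ρ h)·s^⊓-gp_N(ρ h)⁻¹`, `h ∈ Π^tp_Ÿ̲`, read through `m : μ_N(B_N) ≃ μ_N`, IS (the inverse of)
  the theta cocycle `η`;
* `CyclotomicCharacterCompatX` (this seat, gen 0; DERIVED from the Galois dictionary of the constants in
  `Sec5KummerGaloisDictionary.lean`): conjugation by `s^⊓-gp_N(ρ x)` on `μ_N(B_N)` is `χ(aug(ι x))`;
* abc-iut-L2-t2's FROZEN interface fields of `RigidData` (p.272 (PDF p.46) "natural"): `cocycle_lDeltaTheta` (on `l·Δ_Θ` the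
  cocycle `η` IS the tautological reduction `thetaMod : l·Δ_Θ ↠ (l·Δ_Θ) ⊗ ℤ/N ≅ μ_N`) and **`thetaMod_conj`** (`thetaMod` is
  `Π^tp_X`-equivariant for conjugation / the cyclotomic character — "`Δ_Θ ≅ Ẑ(1)`").
THEOREMS: `diffCocycle_conj_eq_of_dictionary` (pointwise: `d(y₀ y y₀⁻¹) = s^⊓-gp_N(ρ y₀) · d(y) · s^⊓-gp_N(ρ y₀)⁻¹` for
`y ∈ Π^tp_Ÿ̲` with `ι y ∈ l·Δ_Θ`, ANY `y₀ ∈ Π^tp_X̲`), `hcup_of_dictionary` (VERBATIM the binder `hcup`, given the coverage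
`hcov` of the `(l·Δ_Θ)`-part by `Π^tp_Ÿ̲ ∩ ι⁻¹(l·Δ_Θ)`, GAP G-w5d123-2 family), and at abc-iut-L2-t4's data
`hKR_ofBiKummerData_of_dictionary` (= G-L6t23-3's wanted decl ON THE NOSE, through `hcup_iff_pull_root_mul`).
HONEST FRAMING: kernel-checked implications between typed statements; the dictionary binders (`ThetaSectionCompat`,
`CyclotomicCharacterCompatX`, coverage) are hypotheses to be instantiated at the genuine data; nothing of [EtTh] is asserted
unconditionally; typed ≠ proved; no side is taken on anything downstream ([IUTchIII] Cor. 3.12).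
-/

noncomputable section

namespace Literature.AnabelianGeometry.EtaleTheta

open CategoryTheory Opposite Literature.AlgebraicGeometry.Frobenioids

universe w v v' u u'

namespace ThetaFrobenioid

/-! ### Generic: any §5 data `𝔉` against any §2 rigidity datum `RD` -/

section Generic

variable {C : Type u} [Category.{v} C] {D : Type u'} [Category.{v'} D] (𝔉 : ThetaFrobenioid.{w} C D)
  {l' : ℕ} (RD : RigidData.{v} 𝔉.N l') (H : 𝔉.Facts) (ι : 𝔉.PiX ≃* RD.PiX)
  (m : 𝔉.muTorsion 𝔉.BN 𝔉.N ≃* RD.mu) (hYdd : 𝔉.IdentifiesPiYdd RD.toThetaEnvData ι)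

/-- **The bi-Kummer difference is `Π^tp_X̲`-conjugation-equivariant over `l·Δ_Θ`** — from the dictionary: for `y ∈ Π^tp_Ÿ̲` with
`ι y ∈ l·Δ_Θ` and ANY `y₀ ∈ Π^tp_X̲`, `d(y₀ y y₀⁻¹) = s^⊓-gp_N(ρ y₀) · d(y) · s^⊓-gp_N(ρ y₀)⁻¹` in `Aut_C(B_N)`, where
`d(h) = s^⊔-gp_N(ρ h) · s^⊓-gp_N(ρ h)⁻¹ ∈ μ_N(B_N)` (abc-iut-L2-t11's `diffCocycle`).  Proof: through `m`, `d = η⁻¹`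
(`ThetaSectionCompat`), `η = thetaMod` on `l·Δ_Θ` (`RigidData.cocycle_lDeltaTheta`), `thetaMod` is conjugation-equivariant for
`χ ∘ aug` (`RigidData.thetaMod_conj`, "`Δ_Θ ≅ Ẑ(1)`"), and `χ(aug(ι y₀))` on `μ_N(B_N)` is conjugation by `s^⊓-gp_N(ρ y₀)`
(`CyclotomicCharacterCompatX`).  [cite: MochizukiEtTh2009, Prop 5.5 proof p.327–328 (PDF pp.101–102)] -/
theorem diffCocycle_conj_eq_of_dictionary {η : RD.PiYdd → RD.mu} (hη : η ∈ RD.thetaCocycles)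
    (hcompat : 𝔉.ThetaSectionCompat H RD.toThetaEnvData ι m hYdd η)
    (hχX : 𝔉.CyclotomicCharacterCompatX RD.toThetaEnvData ι m)
    (y₀ y : 𝔉.PiX) (hy : y ∈ 𝔉.PiYdd) (hθ : (ι y : RD.PiX) ∈ RD.lDeltaTheta) :
    ((𝔉.diffCocycle H ⟨y₀ * y * y₀⁻¹, 𝔉.PiYdd_normal.conj_mem _ hy y₀⟩ : 𝔉.muTorsion 𝔉.BN 𝔉.N) : Aut 𝔉.BN) =
      𝔉.sgpCap (𝔉.ρ y₀) * ((𝔉.diffCocycle H ⟨y, hy⟩ : 𝔉.muTorsion 𝔉.BN 𝔉.N) : Aut 𝔉.BN) *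
        (𝔉.sgpCap (𝔉.ρ y₀))⁻¹ := by
  set u : 𝔉.muTorsion 𝔉.BN 𝔉.N := 𝔉.diffCocycle H ⟨y, hy⟩ with hu
  have hu' : 𝔉.sgpCap (𝔉.ρ y₀) * (u : Aut 𝔉.BN) * (𝔉.sgpCap (𝔉.ρ y₀))⁻¹ ∈ 𝔉.muTorsion 𝔉.BN 𝔉.N :=
    (𝔉.muTorsion_normal 𝔉.BN 𝔉.N).conj_mem _ u.2 _
  -- through `m`: the conjugate is `χ(aug(ι y₀)) · (m u)`
  have h1 : m ⟨_, hu'⟩ = RD.chi (RD.aug (ι y₀)) (m u) := hχX y₀ u ⟨_, hu'⟩ rfl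
  -- through `m`: the difference at the conjugate is `χ(aug(ι y₀)) · (m u)` as well
  have hθ' : (ι y₀ * ι y * (ι y₀)⁻¹ : RD.PiX) ∈ RD.lDeltaTheta := RD.lDeltaTheta_normal.conj_mem _ hθ (ι y₀)
  have hYy : ι y ∈ RD.PiYdd := (hYdd y).mp hy
  have hYc : (ι y₀ * ι y * (ι y₀)⁻¹ : RD.PiX) ∈ RD.PiYdd := RD.PiYdd_normal.conj_mem _ hYy (ι y₀)
  have e1 : (⟨ι (y₀ * y * y₀⁻¹), (hYdd _).mp (𝔉.PiYdd_normal.conj_mem _ hy y₀)⟩ : RD.PiYdd) =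
      ⟨ι y₀ * ι y * (ι y₀)⁻¹, hYc⟩ := Subtype.ext (by simp only [map_mul, map_inv])
  have e2 : (⟨ι y₀ * ι y * (ι y₀)⁻¹, hYc⟩ : RD.PiYdd) =
      ⟨(ι y₀ : RD.PiX) * ((⟨ι y, hYy⟩ : RD.PiYdd) : RD.PiX) * (ι y₀)⁻¹,
        RD.PiYdd_normal.conj_mem _ hYy (ι y₀)⟩ := rfl
  have h2 : m (𝔉.diffCocycle H ⟨y₀ * y * y₀⁻¹, 𝔉.PiYdd_normal.conj_mem _ hy y₀⟩) =
      RD.chi (RD.aug (ι y₀)) (m u) := by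
    rw [hcompat, e1, RD.cocycle_lDeltaTheta η hη _ hθ', RD.thetaMod_conj (ι y₀) ⟨ι y, hθ⟩,
      ← RD.cocycle_lDeltaTheta η hη ⟨ι y, hYy⟩ hθ, ← map_inv]
    congr 1
    rw [hu, hcompat ⟨y, hy⟩]
  have h3 : 𝔉.diffCocycle H ⟨y₀ * y * y₀⁻¹, 𝔉.PiYdd_normal.conj_mem _ hy y₀⟩ = ⟨_, hu'⟩ :=
    m.injective (h2.trans h1.symm)
  exact congrArg Subtype.val h3

/-- **`hcup` FROM THE DICTIONARY** (VERBATIM the binder of `Thm56Sub.cyclotomicRigidity_of_laws` /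
`cyclotomicRigidity_ofBiKummerData_of_laws`, SUBDAG-EtTh-Thm56 leaf P55-L06c): for every `g ∈ Aut_D(B_N^bs)` and `k ∈ H_{B_N}` over
`(l·Δ_Θ)_{B_N}` (`k ∈ P.pre`), `g k g⁻¹ ∈ H_{B_N}` and `s^⊔-gp_N(g k g⁻¹) = s^⊓-gp_N(g) · s^⊔-gp_N(k) · s^⊓-gp_N(g)⁻¹` — given the
dictionary (`ThetaSectionCompat`, `CyclotomicCharacterCompatX`) and the coverage `hcov` of the `(l·Δ_Θ)`-part of `H_{B_N}` by
`Π^tp_Ÿ̲ ∩ ι⁻¹(l·Δ_Θ)` (GAP G-w5d123-2 family).  [cite: MochizukiEtTh2009, Prop 5.5 proof p.327–328 (PDF pp.101–102)] -/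
theorem hcup_of_dictionary {η : RD.PiYdd → RD.mu} (hη : η ∈ RD.thetaCocycles)
    (hcompat : 𝔉.ThetaSectionCompat H RD.toThetaEnvData ι m hYdd η)
    (hχX : 𝔉.CyclotomicCharacterCompatX RD.toThetaEnvData ι m)
    (P : FrobenioidCyclotomicRigidity.ThetaSubquotientProj 𝔉)
    (hcov : ∀ k : 𝔉.HB, (k : Aut (𝔉.base.obj 𝔉.BN)) ∈ P.pre _ →
      ∃ (y : 𝔉.PiX) (_ : y ∈ 𝔉.PiYdd), 𝔉.ρ y = k ∧ (ι y : RD.PiX) ∈ RD.lDeltaTheta) :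
    ∀ (g : Aut (𝔉.base.obj 𝔉.BN)) (k : 𝔉.HB), (k : Aut (𝔉.base.obj 𝔉.BN)) ∈ P.pre _ →
      ∃ hmem : g * (k : Aut (𝔉.base.obj 𝔉.BN)) * g⁻¹ ∈ 𝔉.HB,
        𝔉.sgpCup ⟨g * (k : Aut (𝔉.base.obj 𝔉.BN)) * g⁻¹, hmem⟩ = 𝔉.sgpCap g * 𝔉.sgpCup k * (𝔉.sgpCap g)⁻¹ := by
  intro g k hk
  obtain ⟨y, hy, hyk, hθ⟩ := hcov k hk
  obtain ⟨y₀, rfl⟩ := 𝔉.ρ_surjective g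
  have hk' : k = 𝔉.rhoYdd ⟨y, hy⟩ := Subtype.ext hyk.symm
  subst hk'
  have hmem : 𝔉.ρ y₀ * ((𝔉.rhoYdd ⟨y, hy⟩ : 𝔉.HB) : Aut (𝔉.base.obj 𝔉.BN)) * (𝔉.ρ y₀)⁻¹ ∈ 𝔉.HB :=
    ⟨y₀ * y * y₀⁻¹, 𝔉.PiYdd_normal.conj_mem _ hy y₀, by rw [map_mul, map_mul, map_inv]; rfl⟩
  refine ⟨hmem, ?_⟩
  rw [𝔉.sgpCup_conj_eq_iff]
  -- both sides are inverses of the two sides of `diffCocycle_conj_eq_of_dictionary`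
  have key := 𝔉.diffCocycle_conj_eq_of_dictionary RD H ι m hYdd hη hcompat hχX y₀ y hy hθ
  have eL : ((𝔉.diffCocycle H ⟨y₀ * y * y₀⁻¹, 𝔉.PiYdd_normal.conj_mem _ hy y₀⟩ : 𝔉.muTorsion 𝔉.BN 𝔉.N) :
        Aut 𝔉.BN) =
      𝔉.sgpCup ⟨𝔉.ρ y₀ * ((𝔉.rhoYdd ⟨y, hy⟩ : 𝔉.HB) : Aut (𝔉.base.obj 𝔉.BN)) * (𝔉.ρ y₀)⁻¹, hmem⟩ *
        (𝔉.sgpCap (𝔉.ρ y₀ * ((𝔉.rhoYdd ⟨y, hy⟩ : 𝔉.HB) : Aut (𝔉.base.obj 𝔉.BN)) * (𝔉.ρ y₀)⁻¹))⁻¹ := by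
    have e : 𝔉.rhoYdd ⟨y₀ * y * y₀⁻¹, 𝔉.PiYdd_normal.conj_mem _ hy y₀⟩ =
        ⟨𝔉.ρ y₀ * ((𝔉.rhoYdd ⟨y, hy⟩ : 𝔉.HB) : Aut (𝔉.base.obj 𝔉.BN)) * (𝔉.ρ y₀)⁻¹, hmem⟩ :=
      Subtype.ext (by change 𝔉.ρ (y₀ * y * y₀⁻¹) = _; rw [map_mul, map_mul, map_inv]; rfl)
    change 𝔉.sgpCup (𝔉.rhoYdd _) * (𝔉.sgpCap (𝔉.rhoYdd _ : Aut (𝔉.base.obj 𝔉.BN)))⁻¹ = _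
    rw [e]
    rfl
  have eR : ((𝔉.diffCocycle H ⟨y, hy⟩ : 𝔉.muTorsion 𝔉.BN 𝔉.N) : Aut 𝔉.BN) =
      𝔉.sgpCup (𝔉.rhoYdd ⟨y, hy⟩) * (𝔉.sgpCap ((𝔉.rhoYdd ⟨y, hy⟩ : 𝔉.HB) : Aut (𝔉.base.obj 𝔉.BN)))⁻¹ := rfl
  rw [eL, eR] at key
  have key' := congrArg Inv.inv key
  simp only [mul_inv_rev, inv_inv] at key'
  rw [key']
  simp only [mul_assoc]

end Generic

/-! ### At abc-iut-L2-t4's assembled data: GAP row G-L6t23-3 (`hKR`) from the dictionary -/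

section OfBiKummerData

universe u₀ v₀ u₁ v₁ w₁

variable {K : Type u₀} [Field K] {X : SemiGraphs.TemperedArithmeticGroup.{u₀} K} {D₀ : Type u₀} [Category.{v₀} D₀]
  {V : FrdIMonoidStub.{w₁}} {T₀ : RealifiedDivisorMonoids (D₀ := D₀) V} {D : Type u₁} [Category.{v₁} D]
  {VD : FrdICatStub.{u₁, v₁, w₁} D} {S : BiKummerSetting X T₀ D VD}
  {pullFrac : ∀ {A A' : S.C} (_ : A' ⟶ A), S.biratUnits A → S.biratUnits A'}
  {lv N : ℕ+} {l' : ℕ} {RD : RigidData.{max v₁ w₁} N l'} {θ : S.biratUnits S.Aodot} {Bl : S.C}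
  {Pl : S.FractionPair θ Bl} {Rl : S.NthRoot θ Pl lv pullFrac}
  (h : ModelFrobenioid.Hypotheses S.tf.divisorMonoid S.tf.ratFnFunctor)
  (toB : ∀ A : S.C, S.biratUnits A →* S.tf.biratUnitsModel A) (Q : FrobenioidTheta.ThetaSubquotientStub.{w₁} D)
  (odd_l : Odd (lv : ℕ)) (R : S.NthRoot Rl.root Rl.pair N pullFrac) (ιX : RD.PiX ≃ₜ* X.Pi)
  (hopen : IsOpen ((S.galoisSurj R.AN.base R.αData.isGalois).ker : Set X.Pi)) (σ : Aut R.AN.base →* Aut R.AN)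
  (K' : Type w₁) [Field K'] (constEmb : K'ˣ →* S.tf.biratUnitsModel R.BN)
  (constEmb_injective : Function.Injective constEmb)
  (hdivc : ∀ g : Aut R.BN.base,
    ModelFrobenioid.div ((σ ((BiKummerSetting.NthRoot.baseIso S R).conjAut.symm g)).hom ≫ R.pair.num) =
      ModelFrobenioid.div R.pair.num)
  (hdivp : ∀ y : RD.PiYdd,
    ModelFrobenioid.div ((σ (S.galoisSurj R.AN.base R.αData.isGalois (ιX y.1))).hom ≫ R.pair.den) =
      ModelFrobenioid.div R.pair.den)

/-- **GAP row G-L6t23-3 (`hKR`) FROM THE DICTIONARY, at the assembled data `ofBiKummerData`**: the Kummer cocycle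
`c(γ) = γ^* x / x` of the `N`-th root (`x = toB R.AN R.root`) is multiplicative at `(ρ_{A_N}(ιX y₀), ρ_{A_N}(ιX y))` for every
`y₀ ∈ Π^tp_X̲` and every `y ∈ Π^tp_Ÿ̲` over `(l·Δ_Θ)` — abc-iut-L6-t23's equivalence `hcup_iff_pull_root_mul` applied to
`hcup_of_dictionary` for the §2 datum `RD` itself (`ι := id`).  Inputs: the [FrdI] Prop. 5.6 / Thm. 5.2 (ii) laws `hσ`, `hfrac` of
the data; the dictionary `m`, `ThetaSectionCompat`, `CyclotomicCharacterCompatX`; the coverage `hcov`.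
[cite: MochizukiEtTh2009, Prop 5.5 proof p.327–328 (PDF pp.101–102)] -/
theorem hKR_ofBiKummerData_of_dictionary
    (hσ : ∀ g : Aut R.AN.base, ModelFrobenioid.baseMap (σ g).hom = g.hom)
    (hfrac : ∀ {A B : S.C} (s' s'' : A ⟶ B) (h' : S.IsPreStep s') (h'' : S.IsPreStep s'')
      (hb : PreFrobenioid.BaseEquivalent S.F s' s''),
      (toB A (S.fracOf s' s'' h' h'' hb) : S.tf.ratFnFunctor.obj (op A.base)) *
        ModelFrobenioid.unit s'' = ModelFrobenioid.unit s')
    (P : FrobenioidCyclotomicRigidity.ThetaSubquotientProj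
      (ofBiKummerData h toB Q odd_l R ιX hopen σ K' constEmb constEmb_injective hdivc hdivp))
    (H : (ofBiKummerData h toB Q odd_l R ιX hopen σ K' constEmb constEmb_injective hdivc hdivp).Facts)
    (m : (ofBiKummerData h toB Q odd_l R ιX hopen σ K' constEmb constEmb_injective hdivc hdivp).muTorsion
        (ofBiKummerData h toB Q odd_l R ιX hopen σ K' constEmb constEmb_injective hdivc hdivp).BN
        (ofBiKummerData h toB Q odd_l R ιX hopen σ K' constEmb constEmb_injective hdivc hdivp).N ≃* RD.mu)
    (hYdd : (ofBiKummerData h toB Q odd_l R ιX hopen σ K' constEmb constEmb_injective hdivc hdivp).IdentifiesPiYdd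
      RD.toThetaEnvData (MulEquiv.refl _))
    {η : RD.PiYdd → RD.mu} (hη : η ∈ RD.thetaCocycles)
    (hcompat : (ofBiKummerData h toB Q odd_l R ιX hopen σ K' constEmb constEmb_injective hdivc hdivp).ThetaSectionCompat H
      RD.toThetaEnvData (MulEquiv.refl _) m hYdd η)
    (hχX : (ofBiKummerData h toB Q odd_l R ιX hopen σ K' constEmb constEmb_injective hdivc hdivp).CyclotomicCharacterCompatX
      RD.toThetaEnvData (MulEquiv.refl _) m)
    (hcov : ∀ k : (ofBiKummerData h toB Q odd_l R ιX hopen σ K' constEmb constEmb_injective hdivc hdivp).HB,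
      (k : Aut ((ofBiKummerData h toB Q odd_l R ιX hopen σ K' constEmb constEmb_injective hdivc hdivp).base.obj
        (ofBiKummerData h toB Q odd_l R ιX hopen σ K' constEmb constEmb_injective hdivc hdivp).BN)) ∈ P.pre _ →
      ∃ (y : RD.PiX) (_ : y ∈ RD.PiYdd),
        (ofBiKummerData h toB Q odd_l R ιX hopen σ K' constEmb constEmb_injective hdivc hdivp).ρ y = k ∧
          y ∈ RD.lDeltaTheta) :
    ∀ (y₀ y : RD.PiX), y ∈ RD.PiYdd → rhoOfBiKummerData R ιX y ∈ P.pre R.BN.base →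
      pull S.tf.ratFnFunctor (S.galoisSurj R.AN.base R.αData.isGalois (ιX y)).hom
          (pull S.tf.ratFnFunctor (S.galoisSurj R.AN.base R.αData.isGalois (ιX y₀)).hom
            (toB R.AN R.root : S.tf.ratFnFunctor.obj (op R.AN.base))) *
          (toB R.AN R.root : S.tf.ratFnFunctor.obj (op R.AN.base)) =
        pull S.tf.ratFnFunctor (S.galoisSurj R.AN.base R.αData.isGalois (ιX y)).hom
            (toB R.AN R.root : S.tf.ratFnFunctor.obj (op R.AN.base)) *
          pull S.tf.ratFnFunctor (S.galoisSurj R.AN.base R.αData.isGalois (ιX y₀)).hom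
            (toB R.AN R.root : S.tf.ratFnFunctor.obj (op R.AN.base)) :=
  (hcup_iff_pull_root_mul h toB Q odd_l R ιX hopen σ K' constEmb constEmb_injective hdivc hdivp hσ hfrac P).mp
    ((ofBiKummerData h toB Q odd_l R ιX hopen σ K' constEmb constEmb_injective hdivc hdivp).hcup_of_dictionary RD H
      (MulEquiv.refl _) m hYdd hη hcompat hχX P hcov)

end OfBiKummerData

end ThetaFrobenioid

end Literature.AnabelianGeometry.EtaleTheta

end
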